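import Summits.CriticalPhenomena.PercolationContinuityZ3.Theorems.PercNearOneGluingNoHeavyLowerTailKnQuestion8CoefficientwiseRemSPParallelN
import Summits.CriticalPhenomena.PercolationContinuityZ3.Theorems.PercNearOneGluingNoHeavyLowerTailKnQuestion8CoefficientwiseRemSPParallelR
import HarnessLib

/-!
# THEOREM U3-CLOSURE, parallel step: 𝒰 is closed under parallel composition — prim-lf-2 gen 69

Support file (`--supports stmt-CriticalPhenomena-4575`, closed), prover `prim-lf-2` (gen 69).  No definitions, no named facts, no sorries; standard axioms.
Memo `prim-lf-2/CW-SP-gen69.md` §4.2; combines `hasDomRow_pieceN_parallel` and `hasDomRow_pieceR_parallel`.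
* `Coefficientwise.inU3_parallel` — if `(D₁;x,h), (D₂;x,h) ∈ 𝒰` are disjoint pieces whose edges share only `x ≠ h`, then `(D₁ ∪ D₂; x, h) ∈ 𝒰`.
[cite: KozmaNitzan2024, Questions 8–9 (§5.5 p. 36) (context: the Question-8 pocket covariance programme)]
-/

namespace Summit.CriticalPhenomena.PercolationContinuityZ3.Theorems

open Finset Literature.Probability.Percolation

namespace Coefficientwise

variable {ι V : Type*} [DecidableEq ι] (ends : ι → Sym2 V)

/-- **𝒰 is closed under parallel composition.** [cite: KozmaNitzan2024, Questions 8–9 (§5.5 p. 36) (context)] -/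
theorem inU3_parallel {D₁ D₂ : Finset ι} (hdisj : Disjoint D₁ D₂) {x h : V} (hxh : x ≠ h)
    (hsep : ∀ e ∈ D₁, ∀ e' ∈ D₂, ∀ w : V, w ∈ ends e → w ∈ ends e' → w = x ∨ w = h)
    (h₁ : InU3 ends D₁ x h) (h₂ : InU3 ends D₂ x h) : InU3 ends (D₁ ∪ D₂) x h := by
  intro W
  obtain ⟨hA₁, hB₁, hC₁⟩ := h₁ W
  obtain ⟨hA₂, hB₂, hC₂⟩ := h₂ W
  obtain ⟨hR0, hR1⟩ := hasDomRow_pieceR_parallel ends hdisj hxh hsep W hA₁ hB₁ hC₁ hA₂ hB₂ hC₂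
  exact ⟨hR0, hR1, hasDomRow_pieceN_parallel ends hdisj hxh hsep W hC₁ hC₂⟩

end Coefficientwise

end Summit.CriticalPhenomena.PercolationContinuityZ3.Theorems
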